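import Summits.CriticalPhenomena.PercolationContinuityZ3.Theorems.PercNearOneGluingNoHeavyLowerTailCILIsolatedObserver
import HarnessLib

/-!
# `NoHeavyLowerTail` (stmt-CriticalPhenomena-4575) — RESTRICTED (layered / champion-avoiding) cumulative isolation
# for observers joined only to relays

Support file of lemma factory #5 (`prim-lf-5`, gen 7; memo `run/shared/lean/prim/prim-lf-5/CANDIDATES.md` v9, candidates
A10/A11/A11′; `--supports stmt-CriticalPhenomena-4575`).  No definitions, no named facts, no sorries.

Notation: `μ = prodBernoulli w` on `Fin n`, relays `A`, observer `o`, `π(v) = {x ∈ A : v ↔ x}`, `N = |π(o)|`, level `j`, and a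
set `L ⊆ A` of ALLOWED relays.  For an observer joined only to relays (`w s(o,u) = 0` for `u ∉ A`, `u ≠ o`; any graph behind),
Kozma–Nitzan's Theorem 8 (tree: `KozmaNitzan2024_thm8_event`) applied to the MONOTONE cluster property
`P_L(C) := (j+1 ≤ |C ∩ A|) ∨ (C ∩ A ⊄ L)` gives the **restricted cumulative isolation lemma**

  `μ{1 ≤ N ≤ j, π(o) ⊆ L} ≤ max_{a ∈ L} μ{|π(a)| ≤ j, π(a) ⊆ L}`      (`restrictedCIL_preFKG_of_isolatedObserver`, pre-FKG form),

which contains: the plain CIL of `…CILIsolatedObserver.lean` (`L = A`); the CHAMPION-AVOIDING form (`L = A ∖ {c}`, any relay `c`):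
`μ{1 ≤ N ≤ j, o ↮ c} ≤ max_{a ≠ c} μ{|π(a)| ≤ j}` (`championAvoidingCIL_of_isolatedObserver`, candidate A11′ "CACIL"); and the
LAYERED form (`L = {a : μ(|π(a)| ≤ j) ≤ u}`): pockets all of whose members have lightness `≤ u` carry mass `≤ u`
(`layeredCIL_of_isolatedObserver`, candidate A11 "LAYCIL"; it implies A10 "PCCIL" up to a factor 2).  For general observers these
statements are instances of Kozma–Nitzan's Conjecture 4 (monotone cluster properties) — this file is the one-layer case.
[cite: KozmaNitzan2024, Thm. 8 and Conjecture 4 (p. 32)]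
-/

noncomputable section

namespace Summit.CriticalPhenomena.PercolationContinuityZ3.Theorems

open MeasureTheory Set Literature.Probability.LatticeModels Literature.Probability.Percolation
open scoped Classical BigOperators

variable {n : ℕ}

/-- **Restricted CIL, pre-FKG form, for an observer joined only to relays.**  For every nonempty `L ⊆ A` and level `j`
there is `a ∈ L` with `μ{1 ≤ N ≤ j, π(o) ⊆ L} ≤ μ({o ↔ A} ∩ {|π(a)| ≤ j, π(a) ⊆ L})`.  Proof: KN Theorem 8 for the
monotone cluster property `P_L(C) = (j+1 ≤ |C ∩ A|) ∨ (∃ x ∈ A, x ∈ C, x ∉ L)`; `{1 ≤ N ≤ j, π(o) ⊆ L} = {o↔A} ∖ {P_L(C(o))}`,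
`{o↔A} ∖ {P_L(C(a₀))} ⊆ {o↔A} ∩ {|π(a₀)| ≤ j, π(a₀) ⊆ L}`, and if the witness `a₀` lies outside `L` then `P_L(C(a₀))` always holds,
so the left side vanishes. [this work; cite: KozmaNitzan2024, Thm. 8 (p. 32)] -/
theorem restrictedCIL_preFKG_of_isolatedObserver (w : Sym2 (Fin n) → unitInterval)
    (A L : Finset (Fin n)) (o : Fin n) (j : ℕ) (hL : L.Nonempty) (hLA : L ⊆ A)
    (hiso : ∀ u, u ≠ o → u ∉ A → w s(o, u) = 0) :
    ∃ a ∈ L,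
      (prodBernoulli w).real {ω : BondConfig (Fin n) |
          1 ≤ (A.filter fun x => ω ∈ openConn o x).card ∧
            (A.filter fun x => ω ∈ openConn o x).card ≤ j ∧
              ∀ x ∈ A, ω ∈ openConn o x → x ∈ L} ≤
        (prodBernoulli w).real ((⋃ a' ∈ A, (openConn o a' : Set (BondConfig (Fin n)))) ∩
          {ω : BondConfig (Fin n) | (A.filter fun x => ω ∈ openConn a x).card ≤ j ∧
            ∀ x ∈ A, ω ∈ openConn a x → x ∈ L}) := by
  set μ := prodBernoulli w with hμ
  have hA : A.Nonempty := hL.mono hLA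
  -- the monotone cluster property `(j+1 ≤ |C ∩ A|) ∨ (C ∩ A ⊄ L)`
  set P : Set (Fin n) → Prop := fun S =>
    j + 1 ≤ (A.filter fun x => x ∈ S).card ∨ ∃ x ∈ A, x ∈ S ∧ x ∉ L with hP
  have hPmono : ∀ S T : Set (Fin n), S ⊆ T → P S → P T := by
    intro S T hST hS
    rcases hS with hS | ⟨x, hxA, hxS, hxL⟩
    · exact Or.inl (le_trans hS (card_filter_mem_mono A hST))
    · exact Or.inr ⟨x, hxA, hST hxS, hxL⟩
  obtain ⟨a₀, ha₀, h8⟩ := KozmaNitzan2024_thm8_event w A o P hPmono hA hiso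
  set R : Set (BondConfig (Fin n)) := ⋃ a' ∈ A, (openConn o a' : Set (BondConfig (Fin n))) with hR
  set Uo : Set (BondConfig (Fin n)) := {ω | P (openCluster ω o)} with hUo
  set Ua : Set (BondConfig (Fin n)) := {ω | P (openCluster ω a₀)} with hUa
  have hmemR : ∀ ω, ω ∈ R ↔ 1 ≤ (A.filter fun x => ω ∈ openConn o x).card := by
    intro ω
    rw [Nat.succ_le_iff, Finset.card_pos, Finset.filter_nonempty_iff]
    simp only [hR, mem_iUnion, exists_prop]
  -- the target event is `R ∖ Uo`
  have hE : {ω : BondConfig (Fin n) |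
      1 ≤ (A.filter fun x => ω ∈ openConn o x).card ∧
        (A.filter fun x => ω ∈ openConn o x).card ≤ j ∧
          ∀ x ∈ A, ω ∈ openConn o x → x ∈ L} = R \ Uo := by
    ext ω
    simp only [mem_setOf_eq, mem_sdiff, hmemR, hUo, hP, card_filter_mem_openCluster, not_or, not_le,
      not_exists, not_and, not_not]
    constructor
    · rintro ⟨h1, h2, h3⟩
      exact ⟨h1, by omega, fun x hxA hxC => h3 x hxA hxC⟩
    · rintro ⟨h1, h2, h3⟩
      exact ⟨h1, by omega, fun x hxA hxC => h3 x hxA hxC⟩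
  have e1 : μ.real (R ∩ Uo) + μ.real (R \ Uo) = μ.real R :=
    measureReal_inter_add_sdiff (MeasurableSet.of_discrete : MeasurableSet Uo) (measure_ne_top _ _)
  have e2 : μ.real (R ∩ Ua) + μ.real (R \ Ua) = μ.real R :=
    measureReal_inter_add_sdiff (MeasurableSet.of_discrete : MeasurableSet Ua) (measure_ne_top _ _)
  have h8' : μ.real (R ∩ Ua) ≤ μ.real (R ∩ Uo) := by
    rw [inter_comm R Ua, inter_comm R Uo]
    exact h8
  have hbound : μ.real (R \ Uo) ≤ μ.real (R \ Ua) := by linarith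
  rw [hE]
  by_cases haL : a₀ ∈ L
  · refine ⟨a₀, haL, hbound.trans (measureReal_mono ?_)⟩
    rintro ω ⟨hωR, hωU⟩
    refine ⟨hωR, ?_⟩
    simp only [hUa, hP, mem_setOf_eq, card_filter_mem_openCluster, not_or, not_le, not_exists, not_and,
      not_not] at hωU
    simp only [mem_setOf_eq]
    exact ⟨by omega, fun x hxA hxC => hωU.2 x hxA hxC⟩
  · -- the witness lies outside `L`: `P(C(a₀))` always holds, so `R ∖ Uo` is null
    obtain ⟨a, ha⟩ := hL
    refine ⟨a, ha, ?_⟩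
    have hUa_univ : R \ Ua = ∅ := by
      ext ω
      simp only [mem_sdiff, hUa, hP, mem_setOf_eq, mem_empty_iff_false, iff_false, not_and, not_not]
      intro _
      exact Or.inr ⟨a₀, ha₀, mem_openCluster_self ω a₀, haL⟩
    rw [hUa_univ, measureReal_empty] at hbound
    exact hbound.trans measureReal_nonneg

/-- **Restricted CIL for an observer joined only to relays**: for every nonempty `L ⊆ A` some `a ∈ L` has
`μ{1 ≤ N ≤ j, π(o) ⊆ L} ≤ μ{|π(a)| ≤ j}`. [this work] -/
theorem restrictedCIL_of_isolatedObserver (w : Sym2 (Fin n) → unitInterval)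
    (A L : Finset (Fin n)) (o : Fin n) (j : ℕ) (hL : L.Nonempty) (hLA : L ⊆ A)
    (hiso : ∀ u, u ≠ o → u ∉ A → w s(o, u) = 0) :
    ∃ a ∈ L,
      (prodBernoulli w).real {ω : BondConfig (Fin n) |
          1 ≤ (A.filter fun x => ω ∈ openConn o x).card ∧
            (A.filter fun x => ω ∈ openConn o x).card ≤ j ∧
              ∀ x ∈ A, ω ∈ openConn o x → x ∈ L} ≤
        (prodBernoulli w).real {ω : BondConfig (Fin n) |
          (A.filter fun x => ω ∈ openConn a x).card ≤ j} := by
  obtain ⟨a, ha, h⟩ := restrictedCIL_preFKG_of_isolatedObserver w A L o j hL hLA hiso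
  refine ⟨a, ha, h.trans (measureReal_mono ?_)⟩
  rintro ω ⟨-, hω, -⟩
  exact hω

/-- **Champion-avoiding CIL (candidate "CACIL") for an observer joined only to relays.**  For every relay `c` with
`A ∖ {c} ≠ ∅` and every level `j`, some relay `a ≠ c` satisfies `μ{1 ≤ N ≤ j, o ↮ c} ≤ μ{|π(a)| ≤ j}`: on the event
that the observer misses `c`, the small-pocket mass is paid by the lightness of ANOTHER relay (for the champion `c` this is
strictly more than CIL on `G − c` gives). [this work] -/
theorem championAvoidingCIL_of_isolatedObserver (w : Sym2 (Fin n) → unitInterval)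
    (A : Finset (Fin n)) (o c : Fin n) (j : ℕ) (hAc : (A.erase c).Nonempty)
    (hiso : ∀ u, u ≠ o → u ∉ A → w s(o, u) = 0) :
    ∃ a ∈ A.erase c,
      (prodBernoulli w).real ({ω : BondConfig (Fin n) |
          1 ≤ (A.filter fun x => ω ∈ openConn o x).card ∧
            (A.filter fun x => ω ∈ openConn o x).card ≤ j} ∩ (openConn o c : Set (BondConfig (Fin n)))ᶜ) ≤
        (prodBernoulli w).real {ω : BondConfig (Fin n) |
          (A.filter fun x => ω ∈ openConn a x).card ≤ j} := by
  obtain ⟨a, ha, h⟩ := restrictedCIL_of_isolatedObserver w A (A.erase c) o j hAc (A.erase_subset c) hiso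
  refine ⟨a, ha, le_trans (measureReal_mono ?_) h⟩
  rintro ω ⟨⟨h1, h2⟩, hωc⟩
  refine ⟨h1, h2, fun x hxA hxC => Finset.mem_erase.2 ⟨?_, hxA⟩⟩
  rintro rfl
  exact hωc hxC

/-- **Layered CIL (candidate "LAYCIL") for an observer joined only to relays.**  For every threshold `u ≥ 0` and level `j`:
the mass of nonempty small pockets all of whose members `x` have lightness `μ(|π(x)| ≤ j) ≤ u` is at most `u`. [this work] -/
theorem layeredCIL_of_isolatedObserver (w : Sym2 (Fin n) → unitInterval)
    (A : Finset (Fin n)) (o : Fin n) (j : ℕ) (u : ℝ) (hu : 0 ≤ u)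
    (hiso : ∀ u', u' ≠ o → u' ∉ A → w s(o, u') = 0) :
    (prodBernoulli w).real {ω : BondConfig (Fin n) |
        1 ≤ (A.filter fun x => ω ∈ openConn o x).card ∧
          (A.filter fun x => ω ∈ openConn o x).card ≤ j ∧
            ∀ x ∈ A, ω ∈ openConn o x →
              (prodBernoulli w).real {ω' : BondConfig (Fin n) |
                (A.filter fun y => ω' ∈ openConn x y).card ≤ j} ≤ u} ≤ u := by
  set μ := prodBernoulli w with hμ
  set L : Finset (Fin n) := A.filter fun x =>
    μ.real {ω' : BondConfig (Fin n) | (A.filter fun y => ω' ∈ openConn x y).card ≤ j} ≤ u with hLdef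
  have hLA : L ⊆ A := Finset.filter_subset _ _
  -- rewrite the event with `L`
  have hE : {ω : BondConfig (Fin n) |
      1 ≤ (A.filter fun x => ω ∈ openConn o x).card ∧
        (A.filter fun x => ω ∈ openConn o x).card ≤ j ∧
          ∀ x ∈ A, ω ∈ openConn o x →
            μ.real {ω' : BondConfig (Fin n) | (A.filter fun y => ω' ∈ openConn x y).card ≤ j} ≤ u} =
      {ω : BondConfig (Fin n) |
        1 ≤ (A.filter fun x => ω ∈ openConn o x).card ∧
          (A.filter fun x => ω ∈ openConn o x).card ≤ j ∧
            ∀ x ∈ A, ω ∈ openConn o x → x ∈ L} := by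
    ext ω
    simp only [mem_setOf_eq, hLdef, Finset.mem_filter]
    constructor
    · rintro ⟨h1, h2, h3⟩
      exact ⟨h1, h2, fun x hxA hxC => ⟨hxA, h3 x hxA hxC⟩⟩
    · rintro ⟨h1, h2, h3⟩
      exact ⟨h1, h2, fun x hxA hxC => (h3 x hxA hxC).2⟩
  rw [hE]
  rcases L.eq_empty_or_nonempty with hL0 | hL
  · -- no allowed relay: the event is empty
    have hempty : {ω : BondConfig (Fin n) |
        1 ≤ (A.filter fun x => ω ∈ openConn o x).card ∧
          (A.filter fun x => ω ∈ openConn o x).card ≤ j ∧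
            ∀ x ∈ A, ω ∈ openConn o x → x ∈ L} = ∅ := by
      ext ω
      simp only [mem_setOf_eq, mem_empty_iff_false, iff_false, not_and]
      intro h1 _ h3
      rw [Nat.succ_le_iff, Finset.card_pos, Finset.filter_nonempty_iff] at h1
      obtain ⟨x, hxA, hxC⟩ := h1
      have := h3 x hxA hxC
      rw [hL0] at this
      exact absurd this (Finset.notMem_empty x)
    rw [hempty, measureReal_empty]
    exact hu
  · obtain ⟨a, ha, h⟩ := restrictedCIL_of_isolatedObserver w A L o j hL hLA hiso
    have hau : μ.real {ω' : BondConfig (Fin n) | (A.filter fun y => ω' ∈ openConn a y).card ≤ j} ≤ u := by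
      have := Finset.mem_filter.1 ha
      exact this.2
    exact h.trans hau

end Summit.CriticalPhenomena.PercolationContinuityZ3.Theorems
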